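import Mathlib
import Summits.Ventures.PercRepro2.Independence
import Summits.Ventures.PercRepro2.Harris
import Summits.Ventures.PercRepro2.HCov
import Summits.Ventures.PercRepro2.HCovSwap
import Summits.Ventures.PercRepro2.CutVertexPaths
import Summits.Ventures.PercRepro2.CutOneFarConn
import Summits.Ventures.PercRepro2.CutTwoFarConn
import Summits.Ventures.PercRepro2.CutTwoFarLaw
import Summits.Ventures.PercRepro2.CutTwoFar
import Summits.Ventures.PercRepro2.CutTwoFarHarris
import Summits.Ventures.PercRepro2.CutTwoFarRootsLaw
import Summits.Ventures.PercRepro2.CutTwoFarRightPat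
import Summits.Ventures.PercRepro2.CutTwoFarROConn
import Summits.Ventures.PercRepro2.CutTwoFarROMasses
import Summits.Ventures.PercRepro2.CutTwoFarRO
import Summits.Ventures.PercRepro2.CutTwoFarROSigns
import Summits.Ventures.PercRepro2.CutTwoFarROFull
import Summits.Ventures.PercRepro2.CutTwoFarRBConn
import Summits.Ventures.PercRepro2.CutTwoFarRBMasses
import Summits.Ventures.PercRepro2.CutTwoFarRB
import Summits.Ventures.PercRepro2.CutTwoFarRBSigns
import Summits.Ventures.PercRepro2.CutTwoFarRBFull
import Summits.Ventures.PercRepro2.CutTwoFarRBClass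

/-!
# Two marks behind a cut vertex: THE ROOT-FAR CLASS THEOREMS, BOTH ORIENTATIONS AND BOTH ROOTS
(blind cell PercRepro2, typer-1 g50)

(HCOV) on the four root-far classes of S3.5: a root and `o` behind the cut vertex (`{a₁, o}`,
`{a₂, o}` — T6, `HCov_a1oFar`) and a root and `b` behind it (`{a₁, b}`, `{a₂, b}` — T7,
`HCov_a1bFar`), the two far marks on the left of `CutVertex ends side L v Rt` or on its right
(`CutVertex.symm`), the root `a₁` or the root `a₂` (`CovForm.Gc_swap`).  With `CutTwoFarClasses.lean`
this is (HCOV) on EIGHT of the ten two-far-mark cut-vertex classes.  Own work; standard axioms.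
-/

namespace Summit.Ventures.PercRepro2

open CovForm CutVertexM9

namespace CutTwoFar

section Classes2

variable {V : Type*} {E : Type*} [Fintype E] [DecidableEq E] [Fintype V] [DecidableEq V]
  {R : Type*} [Field R] [LinearOrder R] [IsStrictOrderedRing R]
variable {ends : E → Sym2 V} {side : E → Bool} {L : Set V} {v : V} {Rt : Set V}
  (h : CutVertex ends side L v Rt) {o a₁ a₂ a₃ b : V} {p : E → R} (hp : IsProbVec p)
include h hp

/-- **`a₁` and `o` behind the cut vertex** (T6). -/
theorem HCov_cut_a1o (h₁ : a₁ ∈ L ∨ a₁ = v) (ho : o ∈ L ∨ o = v) (h₂ : a₂ ∈ Rt ∨ a₂ = v)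
    (h3 : a₃ ∈ Rt ∨ a₃ = v) (hb : b ∈ Rt ∨ b = v) : HCov p ends o a₁ a₂ a₃ b :=
  HCov_a1oFar h p h₁ ho h₂ h3 hb hp

/-- **`a₁` and `o` behind the cut vertex**, the sides swapped (T6). -/
theorem HCov_cut_a1o' (h₁ : a₁ ∈ Rt ∨ a₁ = v) (ho : o ∈ Rt ∨ o = v) (h₂ : a₂ ∈ L ∨ a₂ = v)
    (h3 : a₃ ∈ L ∨ a₃ = v) (hb : b ∈ L ∨ b = v) : HCov p ends o a₁ a₂ a₃ b :=
  HCov_a1oFar h.symm p h₁ ho h₂ h3 hb hp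

/-- **`a₂` and `o` behind the cut vertex** (T6, the root symmetry). -/
theorem HCov_cut_a2o (h₂ : a₂ ∈ L ∨ a₂ = v) (ho : o ∈ L ∨ o = v) (h₁ : a₁ ∈ Rt ∨ a₁ = v)
    (h3 : a₃ ∈ Rt ∨ a₃ = v) (hb : b ∈ Rt ∨ b = v) : HCov p ends o a₁ a₂ a₃ b := by
  unfold HCov
  rw [← Gc_swap]
  exact HCov_a1oFar h p h₂ ho h₁ h3 hb hp

/-- **`a₂` and `o` behind the cut vertex**, the sides swapped (T6). -/
theorem HCov_cut_a2o' (h₂ : a₂ ∈ Rt ∨ a₂ = v) (ho : o ∈ Rt ∨ o = v) (h₁ : a₁ ∈ L ∨ a₁ = v)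
    (h3 : a₃ ∈ L ∨ a₃ = v) (hb : b ∈ L ∨ b = v) : HCov p ends o a₁ a₂ a₃ b := by
  unfold HCov
  rw [← Gc_swap]
  exact HCov_a1oFar h.symm p h₂ ho h₁ h3 hb hp

/-- **`a₁` and `b` behind the cut vertex** (T7). -/
theorem HCov_cut_a1b (h₁ : a₁ ∈ L ∨ a₁ = v) (hb : b ∈ L ∨ b = v) (h₂ : a₂ ∈ Rt ∨ a₂ = v)
    (h3 : a₃ ∈ Rt ∨ a₃ = v) (ho : o ∈ Rt ∨ o = v) : HCov p ends o a₁ a₂ a₃ b :=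
  HCov_a1bFar h p h₁ hb h₂ h3 ho hp

/-- **`a₁` and `b` behind the cut vertex**, the sides swapped (T7). -/
theorem HCov_cut_a1b' (h₁ : a₁ ∈ Rt ∨ a₁ = v) (hb : b ∈ Rt ∨ b = v) (h₂ : a₂ ∈ L ∨ a₂ = v)
    (h3 : a₃ ∈ L ∨ a₃ = v) (ho : o ∈ L ∨ o = v) : HCov p ends o a₁ a₂ a₃ b :=
  HCov_a1bFar h.symm p h₁ hb h₂ h3 ho hp

/-- **`a₂` and `b` behind the cut vertex** (T7, the root symmetry). -/
theorem HCov_cut_a2b (h₂ : a₂ ∈ L ∨ a₂ = v) (hb : b ∈ L ∨ b = v) (h₁ : a₁ ∈ Rt ∨ a₁ = v)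
    (h3 : a₃ ∈ Rt ∨ a₃ = v) (ho : o ∈ Rt ∨ o = v) : HCov p ends o a₁ a₂ a₃ b := by
  unfold HCov
  rw [← Gc_swap]
  exact HCov_a1bFar h p h₂ hb h₁ h3 ho hp

/-- **`a₂` and `b` behind the cut vertex**, the sides swapped (T7). -/
theorem HCov_cut_a2b' (h₂ : a₂ ∈ Rt ∨ a₂ = v) (hb : b ∈ Rt ∨ b = v) (h₁ : a₁ ∈ L ∨ a₁ = v)
    (h3 : a₃ ∈ L ∨ a₃ = v) (ho : o ∈ L ∨ o = v) : HCov p ends o a₁ a₂ a₃ b := by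
  unfold HCov
  rw [← Gc_swap]
  exact HCov_a1bFar h.symm p h₂ hb h₁ h3 ho hp

end Classes2

end CutTwoFar

end Summit.Ventures.PercRepro2
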